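import Literature.Analysis.Complex.SeveralVariables
import Mathlib.Analysis.Complex.TaylorSeries
import Mathlib.Analysis.Complex.Liouville
import Mathlib.Analysis.Normed.Ring.InfiniteSum
import HarnessLib

/-!
# Double Taylor expansions of holomorphic functions along two complex directions

Analysis/Complex support file (everything proved). For a function `W : E → ℂ` complex
differentiable on an open set `Ω` of a complex normed space `E`, a base point `a` and two
directions `v₁, v₂`, the two-parameter slice `k (s, t) = W (a + s v₁ + t v₂)` has, around every
closed bidisc `{|s - σ| ≤ R₁} × {|t - σ'| ≤ R₂}` mapped into `Ω`, an absolutely convergent double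
power series expansion

  `k (s, t) = ∑_{j, l} J_{j l} (s - σ)^j (t - σ')^l`,  `|s - σ| < R₁`, `|t - σ'| < R₂`,

with the Cauchy bounds `|J_{j l}| ≤ M / (R₁^j R₂^l)`, `M = sup |k|` on the closed bidisc, and
`J_{j l} = ∂_{v₁}^j ∂_{v₂}^l W (a + σ v₁ + σ' v₂) / (j! l!)` (`hasLocalTaylor₂_comp_affine`). This is
the two-variable case of the power series expansion of holomorphic functions of several
variables (Osgood 1899; Hörmander, *An Introduction to Complex Analysis in Several Variables*,
Thm. 2.2.6), obtained here by iterating Mathlib's one-variable Taylor theorem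
`Complex.hasSum_taylorSeries_on_ball` and Cauchy's estimates
`Complex.norm_iteratedDeriv_le_of_forall_mem_sphere_norm_le`, using from the sibling file
`SeveralVariables.lean` that iterated directional derivatives of holomorphic functions are
holomorphic (`Literature.Analysis.Complex.SCV.differentiableOn_iterate_fderiv_apply`) and that
derivatives of complex-line slices are slices of directional derivatives
(`Literature.Analysis.Complex.SCV.iteratedDeriv_slice_eqOn`).

The packaging predicate `HasLocalTaylor₂ k U V` ("`k : ℂ → ℂ → ℂ` has bounded double Taylor
expansions on every closed bidisc in `U × V`") is what the propagation of positive-definiteness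
under analytic continuation consumes (`Literature/Analysis/Complex/PositiveKernelContinuation.lean`,
Glaser's lemma). Corollary: a function jointly complex differentiable on an open product
`U ×ˢ V ⊆ ℂ × ℂ` has this property (`hasLocalTaylor₂_of_differentiableOn`).

## References

* W. F. Osgood, *Note über analytische Functionen mehrerer Veränderlichen*, Math. Ann. 52 (1899).
* L. Hörmander, *An Introduction to Complex Analysis in Several Variables* (1973), Thm. 2.2.6,
  Thm. 2.2.7 (Cauchy's inequalities). [HormanderSCV1973]

## Mathlib

Used: `Complex.hasSum_taylorSeries_on_ball`, `Complex.norm_iteratedDeriv_le_of_forall_mem_sphere_norm_le`,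
`DifferentiableOn.diffContOnCl_ball`, `HasSum.prod_fiberwise`, `summable_mul_of_summable_norm`,
`Summable.of_norm_bounded`. Absent at the pin: any several-variable power series expansion of
holomorphic functions (no Osgood/Hartogs; cf. the module docstring of `SeveralVariables.lean`).
-/

noncomputable section

open Metric Set Filter
open scoped Topology Nat

namespace Literature.Analysis.Complex

/-- **Bounded double Taylor expansions on bidiscs.** The two-variable function
`k : ℂ → ℂ → ℂ` *has local double Taylor expansions on `U × V`* if for every closed bidisc
`closedBall σ R₁ × closedBall σ' R₂ ⊆ U × V` (`R₁, R₂ > 0`) there are coefficients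
`J : ℕ × ℕ → ℂ` and a constant `M` with the Cauchy-type bounds `‖J (j, l)‖ ≤ M / (R₁^j R₂^l)`
such that `k s t = ∑_{(j,l)} J (j, l) (s - σ)^j (t - σ')^l` (as a `HasSum` over `ℕ × ℕ`, hence
absolutely convergent) for all `|s - σ| < R₁`, `|t - σ'| < R₂`. Holomorphic functions of two
complex variables have this property with `J (j, l) = ∂ₛʲ ∂ₜˡ k (σ, σ') / (j! l!)` and
`M = sup |k|` on the bidisc (Osgood 1899; Hörmander (1973), Thms. 2.2.6–2.2.7); see
`hasLocalTaylor₂_comp_affine`, `hasLocalTaylor₂_of_differentiableOn`. [folklore] -/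
def HasLocalTaylor₂ (k : ℂ → ℂ → ℂ) (U V : Set ℂ) : Prop :=
  ∀ ⦃σ σ' : ℂ⦄ ⦃R₁ R₂ : ℝ⦄, 0 < R₁ → 0 < R₂ → closedBall σ R₁ ⊆ U → closedBall σ' R₂ ⊆ V →
    ∃ (J : ℕ × ℕ → ℂ) (M : ℝ), (∀ p, ‖J p‖ ≤ M / (R₁ ^ p.1 * R₂ ^ p.2)) ∧
      ∀ ⦃s : ℂ⦄, s ∈ ball σ R₁ → ∀ ⦃t : ℂ⦄, t ∈ ball σ' R₂ →
        HasSum (fun p : ℕ × ℕ => J p * ((s - σ) ^ p.1 * (t - σ') ^ p.2)) (k s t)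

/-- `HasLocalTaylor₂` is inherited by smaller domains. [folklore] -/
theorem HasLocalTaylor₂.mono {k : ℂ → ℂ → ℂ} {U V U' V' : Set ℂ} (h : HasLocalTaylor₂ k U V)
    (hU : U' ⊆ U) (hV : V' ⊆ V) : HasLocalTaylor₂ k U' V' :=
  fun _ _ _ _ hR₁ hR₂ hσ hσ' => h hR₁ hR₂ (hσ.trans hU) (hσ'.trans hV)

/-- `HasLocalTaylor₂` only depends on the values of the function on `U × V`. [folklore] -/
theorem HasLocalTaylor₂.congr {k k' : ℂ → ℂ → ℂ} {U V : Set ℂ} (h : HasLocalTaylor₂ k U V)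
    (hk : ∀ s ∈ U, ∀ t ∈ V, k' s t = k s t) : HasLocalTaylor₂ k' U V := by
  intro σ σ' R₁ R₂ hR₁ hR₂ hσ hσ'
  obtain ⟨J, M, hJ, hsum⟩ := h hR₁ hR₂ hσ hσ'
  refine ⟨J, M, hJ, fun s hs t ht => ?_⟩
  rw [hk s (hσ (ball_subset_closedBall hs)) t (hσ' (ball_subset_closedBall ht))]
  exact hsum hs ht

/-- The terms of a double Taylor expansion with Cauchy bounds are dominated by a summable double
geometric series inside the bidisc. [folklore] -/
theorem summable_of_taylor₂_bound {J : ℕ × ℕ → ℂ} {M R₁ R₂ : ℝ} (hR₁ : 0 < R₁) (hR₂ : 0 < R₂)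
    (hJ : ∀ p, ‖J p‖ ≤ M / (R₁ ^ p.1 * R₂ ^ p.2)) {s t σ σ' : ℂ} (hs : s ∈ ball σ R₁)
    (ht : t ∈ ball σ' R₂) :
    Summable fun p : ℕ × ℕ => J p * ((s - σ) ^ p.1 * (t - σ') ^ p.2) := by
  rw [mem_ball, dist_eq_norm] at hs ht
  have hq₁ : ‖s - σ‖ / R₁ < 1 := (div_lt_one hR₁).2 hs
  have hq₂ : ‖t - σ'‖ / R₂ < 1 := (div_lt_one hR₂).2 ht
  have hg₁ : Summable fun j : ℕ => ‖(‖s - σ‖ / R₁) ^ j‖ := by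
    simpa [norm_pow, abs_of_nonneg (div_nonneg (norm_nonneg _) hR₁.le)] using
      summable_geometric_of_lt_one (div_nonneg (norm_nonneg _) hR₁.le) hq₁
  have hg₂ : Summable fun l : ℕ => ‖(‖t - σ'‖ / R₂) ^ l‖ := by
    simpa [norm_pow, abs_of_nonneg (div_nonneg (norm_nonneg _) hR₂.le)] using
      summable_geometric_of_lt_one (div_nonneg (norm_nonneg _) hR₂.le) hq₂
  have hprod : Summable fun p : ℕ × ℕ => (‖s - σ‖ / R₁) ^ p.1 * (‖t - σ'‖ / R₂) ^ p.2 :=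
    summable_mul_of_summable_norm hg₁ hg₂
  have hM : 0 ≤ M := by
    have := hJ (0, 0)
    simp only [pow_zero, mul_one, div_one] at this
    exact (norm_nonneg _).trans this
  refine Summable.of_norm_bounded (hprod.mul_left M) fun p => ?_
  rw [norm_mul, norm_mul, norm_pow, norm_pow]
  calc ‖J p‖ * (‖s - σ‖ ^ p.1 * ‖t - σ'‖ ^ p.2)
      ≤ M / (R₁ ^ p.1 * R₂ ^ p.2) * (‖s - σ‖ ^ p.1 * ‖t - σ'‖ ^ p.2) :=
        mul_le_mul_of_nonneg_right (hJ p) (by positivity)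
    _ = M * ((‖s - σ‖ / R₁) ^ p.1 * (‖t - σ'‖ / R₂) ^ p.2) := by
        rw [div_pow, div_pow]
        field_simp

/-- **Double Taylor expansion along two complex directions** (Osgood 1899; Hörmander (1973),
Thm. 2.2.6 with the Cauchy inequalities of Thm. 2.2.7, two-variable case): if `W : E → ℂ` is
complex differentiable on an open set `Ω` and the affine two-parameter family
`(s, t) ↦ a + s • v₁ + t • v₂` maps `U × V` into `Ω`, then `(s, t) ↦ W (a + s • v₁ + t • v₂)` has
bounded double Taylor expansions on every closed bidisc in `U × V`: around `(σ, σ')` with radii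
`R₁, R₂` the coefficients are `J (j, l) = ∂_{v₁}ʲ ∂_{v₂}ˡ W (a + σ v₁ + σ' v₂) / (j! l!)` and
`‖J (j, l)‖ ≤ M / (R₁ʲ R₂ˡ)` with `M` the supremum of `|W|` on the image of the closed bidisc.
Proof: expand in `t` (one-variable Taylor on the slice along `v₂`), identify the coefficients with
slices of the holomorphic functions `∂_{v₂}ˡ W`, expand these in `s`, bound everything by Cauchy's
estimates, and reassemble the absolutely convergent double series fibrewise. [cite: HormanderSCV1973, Thm 2.2.6] -/
theorem hasLocalTaylor₂_comp_affine {E : Type*} [NormedAddCommGroup E] [NormedSpace ℂ E]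
    {W : E → ℂ} {Ω : Set E} (hW : DifferentiableOn ℂ W Ω) (hΩ : IsOpen Ω) (a v₁ v₂ : E)
    {U V : Set ℂ} (hUV : ∀ s ∈ U, ∀ t ∈ V, a + s • v₁ + t • v₂ ∈ Ω) :
    HasLocalTaylor₂ (fun s t => W (a + s • v₁ + t • v₂)) U V := by
  intro σ σ' R₁ R₂ hR₁ hR₂ hσU hσ'V
  -- the iterated directional derivatives in the direction `v₂`, holomorphic on `Ω`
  set W₂ : ℕ → E → ℂ := fun l => (fderiv ℂ · · v₂)^[l] W with hW₂_def
  have hW₂ : ∀ l, DifferentiableOn ℂ (W₂ l) Ω := fun l =>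
    SCV.differentiableOn_iterate_fderiv_apply hW hΩ v₂ l
  -- the mixed derivatives at the centre
  set D : ℕ → ℕ → ℂ := fun j l => ((fderiv ℂ · · v₁)^[j] (W₂ l)) (a + σ • v₁ + σ' • v₂) with hD_def
  -- a uniform bound on the closed bidisc
  obtain ⟨M, hM⟩ : ∃ M : ℝ, ∀ s ∈ closedBall σ R₁, ∀ t ∈ closedBall σ' R₂,
      ‖W (a + s • v₁ + t • v₂)‖ ≤ M := by
    set Φ : ℂ × ℂ → E := fun p => a + p.1 • v₁ + p.2 • v₂ with hΦ
    have hΦc : Continuous Φ := by fun_prop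
    have hK : IsCompact (Φ '' (closedBall σ R₁ ×ˢ closedBall σ' R₂)) :=
      ((isCompact_closedBall σ R₁).prod (isCompact_closedBall σ' R₂)).image hΦc
    have hKΩ : Φ '' (closedBall σ R₁ ×ˢ closedBall σ' R₂) ⊆ Ω := by
      rintro _ ⟨p, hp, rfl⟩
      exact hUV _ (hσU hp.1) _ (hσ'V hp.2)
    obtain ⟨M, hM⟩ := hK.exists_bound_of_continuousOn (hW.continuousOn.mono hKΩ)
    exact ⟨M, fun s hs t ht => hM _ ⟨(s, t), ⟨hs, ht⟩, rfl⟩⟩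
  -- Step 1: expansion in `t` for fixed `s ∈ closedBall σ R₁`, with Cauchy bounds
  have step1 : ∀ s ∈ closedBall σ R₁,
      (∀ l, ‖W₂ l (a + s • v₁ + σ' • v₂)‖ ≤ l ! * M / R₂ ^ l) ∧
      ∀ t ∈ ball σ' R₂, HasSum (fun l : ℕ => (l ! : ℂ)⁻¹ • (t - σ') ^ l • W₂ l (a + s • v₁ + σ' • v₂))
        (W (a + s • v₁ + t • v₂)) := by
    intro s hs
    set x : E := a + s • v₁ with hx
    set g : ℂ → ℂ := fun t => W (x + t • v₂) with hg
    have hslice : closedBall σ' R₂ ⊆ {t : ℂ | x + t • v₂ ∈ Ω} := fun t ht => hUV s (hσU hs) t (hσ'V ht)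
    have hgd : DifferentiableOn ℂ g {t : ℂ | x + t • v₂ ∈ Ω} := SCV.differentiableOn_slice hW x v₂
    have hider : ∀ l, ∀ t ∈ closedBall σ' R₂, iteratedDeriv l g t = W₂ l (x + t • v₂) :=
      fun l t ht => SCV.iteratedDeriv_slice_eqOn hW hΩ x v₂ l (hslice ht)
    refine ⟨fun l => ?_, fun t ht => ?_⟩
    · have hc := Complex.norm_iteratedDeriv_le_of_forall_mem_sphere_norm_le (f := g) (c := σ') l hR₂
        (hgd.diffContOnCl_ball hslice) (fun z hz => hM s hs z (sphere_subset_closedBall hz))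
      rwa [hider l σ' (mem_closedBall_self hR₂.le)] at hc
    · have h := Complex.hasSum_taylorSeries_on_ball (hgd.mono (ball_subset_closedBall.trans hslice)) ht
      have hfun : (fun n : ℕ => (n ! : ℂ)⁻¹ • (t - σ') ^ n • iteratedDeriv n g σ') =
          fun l : ℕ => (l ! : ℂ)⁻¹ • (t - σ') ^ l • W₂ l (a + s • v₁ + σ' • v₂) := by
        funext l
        rw [hider l σ' (mem_closedBall_self hR₂.le)]
      rw [hfun] at h
      exact h
  -- Step 2: expansion in `s` of the coefficient functions `B_l s = ∂_{v₂}ˡ W (a + s v₁ + σ' v₂)`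
  have step2 : ∀ l,
      (∀ j, ‖D j l‖ ≤ j ! * (l ! * M / R₂ ^ l) / R₁ ^ j) ∧
      ∀ s ∈ ball σ R₁, HasSum (fun j : ℕ => (j ! : ℂ)⁻¹ • (s - σ) ^ j • D j l)
        (W₂ l (a + s • v₁ + σ' • v₂)) := by
    intro l
    set y : E := a + σ' • v₂ with hy
    have hpt : ∀ s : ℂ, a + s • v₁ + σ' • v₂ = y + s • v₁ := fun s => by rw [hy]; abel
    set B : ℂ → ℂ := fun s => W₂ l (y + s • v₁) with hB
    have hslice : closedBall σ R₁ ⊆ {s : ℂ | y + s • v₁ ∈ Ω} := fun s hs => by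
      have := hUV s (hσU hs) σ' (hσ'V (mem_closedBall_self hR₂.le))
      rwa [hpt] at this
    have hBd : DifferentiableOn ℂ B {s : ℂ | y + s • v₁ ∈ Ω} := SCV.differentiableOn_slice (hW₂ l) y v₁
    have hider : ∀ j, ∀ s ∈ closedBall σ R₁,
        iteratedDeriv j B s = ((fderiv ℂ · · v₁)^[j] (W₂ l)) (y + s • v₁) :=
      fun j s hs => SCV.iteratedDeriv_slice_eqOn (hW₂ l) hΩ y v₁ j (hslice hs)
    have hDj : ∀ j, iteratedDeriv j B σ = D j l := fun j => by
      rw [hider j σ (mem_closedBall_self hR₁.le), hD_def, hpt]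
    refine ⟨fun j => ?_, fun s hs => ?_⟩
    · have hc := Complex.norm_iteratedDeriv_le_of_forall_mem_sphere_norm_le (f := B) (c := σ) j hR₁
        (hBd.diffContOnCl_ball hslice) (fun z hz => by
          have := (step1 z (sphere_subset_closedBall hz)).1 l
          rwa [hpt] at this)
      rwa [hDj] at hc
    · have h := Complex.hasSum_taylorSeries_on_ball (hBd.mono (ball_subset_closedBall.trans hslice)) hs
      have hfun : (fun n : ℕ => (n ! : ℂ)⁻¹ • (s - σ) ^ n • iteratedDeriv n B σ) =
          fun j : ℕ => (j ! : ℂ)⁻¹ • (s - σ) ^ j • D j l := by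
        funext j; rw [hDj]
      rw [hfun] at h
      simpa only [hB, hpt] using h
  -- Step 3: the coefficients and their bounds
  refine ⟨fun p => (p.1 ! : ℂ)⁻¹ * (p.2 ! : ℂ)⁻¹ * D p.1 p.2, M, fun p => ?_, fun s hs t ht => ?_⟩
  · have hb := (step2 p.2).1 p.1
    have hj : (0 : ℝ) < p.1 ! := by exact_mod_cast Nat.factorial_pos _
    have hl : (0 : ℝ) < p.2 ! := by exact_mod_cast Nat.factorial_pos _
    rw [norm_mul, norm_mul, norm_inv, norm_inv, Complex.norm_natCast, Complex.norm_natCast]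
    calc ((p.1 ! : ℝ))⁻¹ * ((p.2 ! : ℝ))⁻¹ * ‖D p.1 p.2‖
        ≤ ((p.1 ! : ℝ))⁻¹ * ((p.2 ! : ℝ))⁻¹ * (p.1 ! * (p.2 ! * M / R₂ ^ p.2) / R₁ ^ p.1) :=
          mul_le_mul_of_nonneg_left hb (by positivity)
      _ = M / (R₁ ^ p.1 * R₂ ^ p.2) := by
          field_simp
  -- Step 4: reassemble the double series
  · set F : ℕ × ℕ → ℂ := fun p => (p.1 ! : ℂ)⁻¹ * (p.2 ! : ℂ)⁻¹ * D p.1 p.2 *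
      ((s - σ) ^ p.1 * (t - σ') ^ p.2) with hF
    have hbound : ∀ p : ℕ × ℕ, ‖(p.1 ! : ℂ)⁻¹ * (p.2 ! : ℂ)⁻¹ * D p.1 p.2‖ ≤ M / (R₁ ^ p.1 * R₂ ^ p.2) := by
      intro p
      have hb := (step2 p.2).1 p.1
      have hj : (0 : ℝ) < p.1 ! := by exact_mod_cast Nat.factorial_pos _
      have hl : (0 : ℝ) < p.2 ! := by exact_mod_cast Nat.factorial_pos _
      rw [norm_mul, norm_mul, norm_inv, norm_inv, Complex.norm_natCast, Complex.norm_natCast]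
      calc ((p.1 ! : ℝ))⁻¹ * ((p.2 ! : ℝ))⁻¹ * ‖D p.1 p.2‖
          ≤ ((p.1 ! : ℝ))⁻¹ * ((p.2 ! : ℝ))⁻¹ * (p.1 ! * (p.2 ! * M / R₂ ^ p.2) / R₁ ^ p.1) :=
            mul_le_mul_of_nonneg_left hb (by positivity)
        _ = M / (R₁ ^ p.1 * R₂ ^ p.2) := by
            field_simp
    have hFs : Summable F := summable_of_taylor₂_bound hR₁ hR₂ hbound hs ht
    -- fibrewise (over `l`) sums of the swapped family
    have hswap : HasSum (F ∘ (Equiv.prodComm ℕ ℕ)) (∑' p, F p) :=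
      (Equiv.hasSum_iff (Equiv.prodComm ℕ ℕ)).2 hFs.hasSum
    have hfib : ∀ l : ℕ, HasSum (fun j : ℕ => (F ∘ Equiv.prodComm ℕ ℕ) (l, j))
        ((l ! : ℂ)⁻¹ • (t - σ') ^ l • W₂ l (a + s • v₁ + σ' • v₂)) := by
      intro l
      have h := ((step2 l).2 s hs).mul_left ((l ! : ℂ)⁻¹ * (t - σ') ^ l)
      have hfun : (fun j : ℕ => (l ! : ℂ)⁻¹ * (t - σ') ^ l * ((j ! : ℂ)⁻¹ • (s - σ) ^ j • D j l)) =
          fun j : ℕ => (F ∘ Equiv.prodComm ℕ ℕ) (l, j) := by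
        funext j
        simp only [hF, Function.comp_apply, Equiv.prodComm_apply, Prod.swap_prod_mk, smul_eq_mul]
        ring
      rw [hfun] at h
      simpa only [smul_eq_mul, mul_assoc] using h
    have hG := hswap.prod_fiberwise hfib
    have heq : (∑' p, F p) = W (a + s • v₁ + t • v₂) :=
      hG.unique ((step1 s (ball_subset_closedBall hs)).2 t ht)
    show HasSum F (W (a + s • v₁ + t • v₂))
    rw [← heq]
    exact hFs.hasSum

/-- **Jointly holomorphic functions of two complex variables have bounded double Taylor
expansions** (Osgood 1899; Hörmander (1973), Thm. 2.2.6): if `(s, t) ↦ k s t` is complex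
(Fréchet) differentiable on an open product `U ×ˢ V ⊆ ℂ × ℂ`, then `HasLocalTaylor₂ k U V`
(the case `E = ℂ × ℂ`, `a = 0`, `v₁ = (1, 0)`, `v₂ = (0, 1)` of `hasLocalTaylor₂_comp_affine`).
[cite: HormanderSCV1973, Thm 2.2.6] -/
theorem hasLocalTaylor₂_of_differentiableOn {k : ℂ → ℂ → ℂ} {U V : Set ℂ}
    (hk : DifferentiableOn ℂ (Function.uncurry k) (U ×ˢ V)) (hU : IsOpen U) (hV : IsOpen V) :
    HasLocalTaylor₂ k U V := by
  have h := hasLocalTaylor₂_comp_affine hk (hU.prod hV) (0 : ℂ × ℂ) (1, 0) (0, 1) (U := U) (V := V)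
    (fun s hs t ht => by simpa using And.intro hs ht)
  refine h.congr fun s _ t _ => ?_
  simp [Function.uncurry]

end Literature.Analysis.Complex
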